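import Literature.Probability.RandomPlanarGeometry.LoewnerPointFlow
import Literature.Probability.RandomPlanarGeometry.LoewnerAdaptedPlane
import Literature.Probability.RandomPlanarGeometry.LoewnerCotArgExit
import Literature.Probability.RandomPlanarGeometry.SLEAdaptedProofs
import Literature.Probability.Process.ContinuousHitting
import Literature.Probability.Process.RightContinuousProgressive
import HarnessLib

/-!
# The SLE_κ flow of a point of `ℍ`: adaptedness, regularity, and localizing stopping times

Topic `Probability/RandomPlanarGeometry`; theorems and definitions serving the discharge of
Rohde–Schramm's Lemma 6.3 (`κ < 8`; the named fact
`Literature.Probability.RandomPlanarGeometry.exists_tendsto_sleDerivRatio_of_lt_eight`). For the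
SLE_κ driving function `W = √κ B` on the canonical space and a point `z` with `0 < im z` we
consider Rohde–Schramm's centred flow `zₜ = xₜ + i yₜ = gₜ(z) - Wₜ` (proof of Lemma 6.3, p. 904)
as a pair of real processes on `(ℝ≥0 → ℝ, 𝓕ᵂ, preWienerMeasure)`:

* `slePointRe κ z t ω = xₜ = re (centredMap (√κ B(ω)) t z)` (junk `re z - Wₜ` from the swallowing
  time `τ(z)` on, from the junk value of `Loewner.map`) and `slePointIm κ z t ω = yₜ`, *frozen at
  `0` from `τ(z)` on* (`Loewner.imFlowStop`, a continuous path);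
* **adaptedness**: both are adapted to the raw Brownian filtration (`adapted_slePointRe`,
  `adapted_slePointIm`), by the measurable dependence of the Loewner flow of a point of `ℍ` on the
  path up to the present (`Loewner.measurable_map_of_im_pos`, `LoewnerAdaptedPlane.lean`), and
  **progressively measurable** (`isStronglyProgressive_slePointRe`: the paths of `x` are
  right-continuous — continuous before `τ(z)`, equal to the continuous `re z - W` after;
  `isStronglyProgressive_slePointIm`: continuous paths);
* **localization**: the stopping times
  `slePointLocTime κ z n = Hₙ ∧ Sₙ ∧ (n+1)`, where `Hₙ` is the first time `yₜ ≤ im z/(n+2)` and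
  `Sₙ` the first time `|Wₜ| ≥ n+1` (hitting times of closed sets by continuous adapted processes,
  `Literature.Probability.Process.isStoppingTime_hittingAfter_of_continuous`). Along every path:
  `ρₙ < τ(z)` (at a finite swallowing time `yₜ ↓ 0`, `Loewner.imFlowStop_lt_of_near_swallowingTime`),
  `ρₙ ≤ n+1`, on `[0, ρₙ]` one has `yₜ ≥ im z/(n+2)` and `|Wₜ| ≤ n+1`, `ρₙ` is non-decreasing in
  `n`, and every `t < τ(z)` satisfies `t ≤ ρₙ` for `n` large (`exists_le_slePointLocTime`) — the
  "increasing sequence of stopping times `tₙ < τ(ẑ)` with `lim tₙ = τ(ẑ)`" of Rohde–Schramm's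
  proof (p. 905), chosen so that all coefficients of the Itô calculus stay bounded.

## References

* S. Rohde, O. Schramm, *Basic properties of SLE*, Ann. of Math. 161 (2005), proof of Lemma 6.3
  (pp. 904–905).
* D. Revuz, M. Yor, *Continuous Martingales and Brownian Motion* (1999), Ch. I §4 (hitting times),
  Ch. IV §1 (localization).
-/

noncomputable section

open Set Filter MeasureTheory Metric Complex
open _root_.Topology
open scoped NNReal

namespace Literature.Probability.RandomPlanarGeometry

open Loewner Literature.Probability.Process

variable (κ : ℝ≥0) (z : ℂ)

/-! ### The processes `xₜ`, `yₜ` -/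

/-- Rohde–Schramm's **`xₜ = re(gₜ(z) - Wₜ)`** for the SLE_κ flow of `z` (driving function `√κ B(ω)`),
as a process on the canonical space; junk value `re z - Wₜ` from the swallowing time on.
[cite: RohdeSchramm2005, Lemma 6.3 (proof)] -/
def slePointRe (t : ℝ≥0) (ω : ℝ≥0 → ℝ) : ℝ :=
  (centredMap (sleDriving κ ω) t z).re

/-- Rohde–Schramm's **`yₜ = im gₜ(z)`** for the SLE_κ flow of `z`, frozen at `0` from the swallowing
time `τ(z)` on (`Loewner.imFlowStop`), as a process on the canonical space.
[cite: RohdeSchramm2005, Lemma 6.3 (proof)] -/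
def slePointIm (t : ℝ≥0) (ω : ℝ≥0 → ℝ) : ℝ :=
  imFlowStop (sleDriving κ ω) z t

variable {κ z}

/-- Unfolding of `slePointRe`. [folklore] -/
theorem slePointRe_apply (t : ℝ≥0) (ω : ℝ≥0 → ℝ) :
    slePointRe κ z t ω = (sleMap κ ω t z).re - sleDriving κ ω t := by
  rw [slePointRe, centredMap_apply, sub_re, ofReal_re]
  rfl

/-- Unfolding of `slePointIm`. [folklore] -/
theorem slePointIm_apply (t : ℝ≥0) (ω : ℝ≥0 → ℝ) :
    slePointIm κ z t ω = imFlowStop (sleDriving κ ω) z t := rfl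

/-- Before the swallowing time, `yₜ = im gₜ(z) = im zₜ`. [folklore] -/
theorem slePointIm_of_lt {t : ℝ≥0} {ω : ℝ≥0 → ℝ}
    (ht : (t : WithTop ℝ≥0) < swallowingTime (sleDriving κ ω) z) :
    slePointIm κ z t ω = (centredMap (sleDriving κ ω) t z).im := by
  rw [slePointIm, imFlowStop_of_lt ht, im_centredMap]

/-! ### Adaptedness -/

/-- The SLE_κ Loewner map at a point of `ℍ` is `𝓕ᵂ_t`-measurable (`Loewner.measurable_map_of_im_pos`).
[cite: RohdeSchramm2005, §2.1] -/
theorem measurable_sleMap_apply (κ : ℝ≥0) (hz : 0 < z.im) (t : ℝ≥0) :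
    Measurable[brownianFiltration t] fun ω ↦ sleMap κ ω t z :=
  measurable_map_of_im_pos (mΩ := brownianFiltration t) (W := fun ω ↦ sleDriving κ ω) (t := t)
    (fun ω ↦ continuous_sleDriving κ ω) (fun _ hs ↦ measurable_sleDriving_of_le κ hs) hz

/-- `{t < τ(z)} ∈ 𝓕ᵂ_t` for a point `z` of `ℍ` (`Loewner.measurableSet_lt_swallowingTime_of_im_pos`).
[cite: RohdeSchramm2005, §2.1] -/
theorem measurableSet_lt_swallowingTime_of_im_pos_sle (κ : ℝ≥0) (hz : 0 < z.im) (t : ℝ≥0) :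
    MeasurableSet[brownianFiltration t]
      {ω | (t : WithTop ℝ≥0) < swallowingTime (sleDriving κ ω) z} :=
  measurableSet_lt_swallowingTime_of_im_pos (mΩ := brownianFiltration t)
    (W := fun ω ↦ sleDriving κ ω) (t := t) (fun ω ↦ continuous_sleDriving κ ω)
    (fun _ hs ↦ measurable_sleDriving_of_le κ hs) hz

/-- `x` is adapted to the raw Brownian filtration. [folklore] -/
theorem adapted_slePointRe (κ : ℝ≥0) (hz : 0 < z.im) : Adapted brownianFiltration (slePointRe κ z) := by
  intro t
  have h : (fun ω ↦ slePointRe κ z t ω) = fun ω ↦ (sleMap κ ω t z).re - sleDriving κ ω t :=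
    funext fun ω ↦ slePointRe_apply t ω
  rw [show slePointRe κ z t = fun ω ↦ slePointRe κ z t ω from rfl, h]
  exact (Complex.measurable_re.comp (measurable_sleMap_apply κ hz t)).sub
    (measurable_sleDriving_of_le κ le_rfl)

/-- `y` is adapted to the raw Brownian filtration. [folklore] -/
theorem adapted_slePointIm (κ : ℝ≥0) (hz : 0 < z.im) : Adapted brownianFiltration (slePointIm κ z) := by
  intro t
  classical
  have h : (fun ω ↦ slePointIm κ z t ω) = fun ω ↦
      if (t : WithTop ℝ≥0) < swallowingTime (sleDriving κ ω) z then (sleMap κ ω t z).im else 0 := by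
    funext ω; rfl
  rw [show slePointIm κ z t = fun ω ↦ slePointIm κ z t ω from rfl, h]
  exact Measurable.ite (measurableSet_lt_swallowingTime_of_im_pos_sle κ hz t)
    (Complex.measurable_im.comp (measurable_sleMap_apply κ hz t)) measurable_const

/-! ### Path regularity -/

/-- Every path of `y` is continuous (`Loewner.continuous_imFlowStop`). [folklore] -/
theorem continuous_slePointIm (hz : 0 < z.im) (ω : ℝ≥0 → ℝ) : Continuous fun t ↦ slePointIm κ z t ω :=
  continuous_imFlowStop (continuous_sleDriving κ ω) hz

/-- `x` is continuous on `{t | t < τ(z)}`. [folklore] -/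
theorem continuousOn_slePointRe (hz : 0 < z.im) (ω : ℝ≥0 → ℝ) :
    ContinuousOn (fun t ↦ slePointRe κ z t ω)
      {t | (t : WithTop ℝ≥0) < swallowingTime (sleDriving κ ω) z} :=
  continuous_re.comp_continuousOn (continuousOn_centredMap (continuous_sleDriving κ ω)
    (ne_driving_of_im_pos hz 0))

/-- The set of times `{s | ↑s < T}` is open in `ℝ≥0` (private copy of
`isOpen_setOf_coe_lt` of `SLECrossingProbabilityProofs.lean`, not imported here). [folklore] -/
private theorem isOpen_setOf_coe_lt_withTop (T : WithTop ℝ≥0) : IsOpen {s : ℝ≥0 | (s : WithTop ℝ≥0) < T} := by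
  induction T using WithTop.recTopCoe with
  | top =>
    have : {s : ℝ≥0 | (s : WithTop ℝ≥0) < ⊤} = univ := eq_univ_of_forall fun s ↦ WithTop.coe_lt_top s
    rw [this]; exact isOpen_univ
  | coe b => simp only [WithTop.coe_lt_coe]; exact isOpen_Iio

/-- **Every path of `x` is right-continuous**: continuous before `τ(z)`, and equal to the
continuous function `re z - W` from `τ(z)` on (junk value of `Loewner.map`). [folklore] -/
theorem continuousWithinAt_slePointRe (hz : 0 < z.im) (ω : ℝ≥0 → ℝ) (t : ℝ≥0) :
    ContinuousWithinAt (fun s ↦ slePointRe κ z s ω) (Ici t) t := by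
  by_cases ht : (t : WithTop ℝ≥0) < swallowingTime (sleDriving κ ω) z
  · exact ((continuousOn_slePointRe hz ω).continuousAt
      ((isOpen_setOf_coe_lt_withTop _).mem_nhds ht)).continuousWithinAt
  · have heq : ∀ s ∈ Ici t, slePointRe κ z s ω = z.re - sleDriving κ ω s := by
      intro s hs
      have hs' : ¬ (s : WithTop ℝ≥0) < swallowingTime (sleDriving κ ω) z :=
        fun h ↦ ht (lt_of_le_of_lt (WithTop.coe_le_coe.2 hs) h)
      rw [slePointRe_apply, sleMap, map_of_not_lt_swallowingTime hs']
    have hc : ContinuousWithinAt (fun s ↦ z.re - sleDriving κ ω s) (Ici t) t :=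
      (continuous_const.sub (continuous_sleDriving κ ω)).continuousWithinAt
    exact hc.congr heq (heq t (mem_Ici.2 le_rfl))

/-- **`x` is progressively measurable** (adapted with right-continuous paths). [folklore] -/
theorem isStronglyProgressive_slePointRe (κ : ℝ≥0) (hz : 0 < z.im) :
    IsStronglyProgressive brownianFiltration (slePointRe κ z) :=
  isStronglyProgressive_of_rightContinuous (adapted_slePointRe κ hz)
    fun ω t ↦ continuousWithinAt_slePointRe hz ω t

/-- `y` is strongly adapted. [folklore] -/
theorem stronglyAdapted_slePointIm (κ : ℝ≥0) (hz : 0 < z.im) :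
    StronglyAdapted brownianFiltration (slePointIm κ z) :=
  (adapted_slePointIm κ hz).stronglyAdapted

/-- **`y` is progressively measurable** (adapted with continuous paths). [folklore] -/
theorem isStronglyProgressive_slePointIm (κ : ℝ≥0) (hz : 0 < z.im) :
    IsStronglyProgressive brownianFiltration (slePointIm κ z) :=
  (stronglyAdapted_slePointIm κ hz).isStronglyProgressive_of_continuous (continuous_slePointIm hz)

/-! ### The localizing stopping times -/

variable (κ z) in
/-- `Hₙ`: the first time the (frozen) imaginary part `yₜ` is `≤ im z/(n+2)`. [folklore] -/
def slePointImTime (n : ℕ) : (ℝ≥0 → ℝ) → WithTop ℝ≥0 :=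
  hittingAfter (slePointIm κ z) (Iic (z.im / (n + 2))) 0

variable (κ) in
/-- `Sₙ`: the first time `|Wₜ| ≥ n + 1`. [folklore] -/
def sleDrivingTime (n : ℕ) : (ℝ≥0 → ℝ) → WithTop ℝ≥0 :=
  hittingAfter (fun t ω ↦ |sleDriving κ ω t|) (Ici ((n : ℝ) + 1)) 0

variable (κ z) in
/-- The **localizing stopping times** `ρₙ = Hₙ ∧ Sₙ ∧ (n+1)` for the Itô calculus of `zₜ`: before
`ρₙ`, `yₜ ≥ im z/(n+2)`, `|Wₜ| ≤ n+1` and `t ≤ n+1`. Rohde–Schramm (2005), proof of Lemma 6.3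
("there is an increasing sequence of stopping times `tₙ < τ(ẑ)` with `limₙ tₙ = τ(ẑ)`", p. 905).
[cite: RohdeSchramm2005, Lemma 6.3 (proof)] -/
def slePointLocTime (n : ℕ) (ω : ℝ≥0 → ℝ) : WithTop ℝ≥0 :=
  min (slePointImTime κ z n ω) (min (sleDrivingTime κ n ω) (((n : ℝ≥0) + 1 : ℝ≥0) : WithTop ℝ≥0))

/-- The level `im z/(n+2)` is positive and below `im z`. [folklore] -/
theorem level_pos_lt (hz : 0 < z.im) (n : ℕ) : 0 < z.im / (n + 2) ∧ z.im / (n + 2) < z.im := by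
  refine ⟨by positivity, ?_⟩
  rw [div_lt_iff₀ (by positivity)]
  nlinarith

/-- `Hₙ` is a stopping time of the raw Brownian filtration. [folklore] -/
theorem isStoppingTime_slePointImTime (κ : ℝ≥0) (hz : 0 < z.im) (n : ℕ) :
    IsStoppingTime brownianFiltration (slePointImTime κ z n) :=
  isStoppingTime_hittingAfter_of_continuous (adapted_slePointIm κ hz) (continuous_slePointIm hz)
    isClosed_Iic

/-- `|W|` is adapted. [folklore] -/
theorem adapted_abs_sleDriving (κ : ℝ≥0) : Adapted brownianFiltration fun t ω ↦ |sleDriving κ ω t| :=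
  fun t ↦ continuous_abs.measurable.comp (measurable_sleDriving_of_le κ (le_refl t))

/-- `Sₙ` is a stopping time of the raw Brownian filtration. [folklore] -/
theorem isStoppingTime_sleDrivingTime (κ : ℝ≥0) (n : ℕ) :
    IsStoppingTime brownianFiltration (sleDrivingTime κ n) :=
  isStoppingTime_hittingAfter_of_continuous (adapted_abs_sleDriving κ)
    (fun ω ↦ (continuous_sleDriving κ ω).abs) isClosed_Ici

/-- **`ρₙ` is a stopping time** of the raw Brownian filtration. [folklore] -/
theorem isStoppingTime_slePointLocTime (κ : ℝ≥0) (hz : 0 < z.im) (n : ℕ) :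
    IsStoppingTime brownianFiltration (slePointLocTime κ z n) :=
  (isStoppingTime_slePointImTime κ hz n).min
    ((isStoppingTime_sleDrivingTime κ n).min (isStoppingTime_const _ _))

/-- `ρₙ ≤ n + 1`. [folklore] -/
theorem slePointLocTime_le (n : ℕ) (ω : ℝ≥0 → ℝ) :
    slePointLocTime κ z n ω ≤ (((n : ℝ≥0) + 1 : ℝ≥0) : WithTop ℝ≥0) :=
  (min_le_right _ _).trans (min_le_right _ _)

/-- `ρₙ < ⊤`. [folklore] -/
theorem slePointLocTime_ne_top (n : ℕ) (ω : ℝ≥0 → ℝ) : slePointLocTime κ z n ω ≠ ⊤ :=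
  ne_top_of_le_ne_top WithTop.coe_ne_top (slePointLocTime_le n ω)

/-- `ρₙ ≤ Hₙ`. [folklore] -/
theorem slePointLocTime_le_imTime (n : ℕ) (ω : ℝ≥0 → ℝ) :
    slePointLocTime κ z n ω ≤ slePointImTime κ z n ω := min_le_left _ _

/-- `ρₙ ≤ Sₙ`. [folklore] -/
theorem slePointLocTime_le_drivingTime (n : ℕ) (ω : ℝ≥0 → ℝ) :
    slePointLocTime κ z n ω ≤ sleDrivingTime κ n ω := (min_le_right _ _).trans (min_le_left _ _)

/-- **`ρₙ < τ(z)`**: at a finite swallowing time the frozen imaginary part drops below every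
positive level strictly before it (`Loewner.imFlowStop_lt_of_near_swallowingTime`), so `Hₙ < τ(z)`;
and `ρₙ ≤ n + 1 < ⊤`. [cite: RohdeSchramm2005, Lemma 6.3 (proof)] -/
theorem slePointLocTime_lt_swallowingTime (hz : 0 < z.im) (n : ℕ) (ω : ℝ≥0 → ℝ) :
    slePointLocTime κ z n ω < swallowingTime (sleDriving κ ω) z := by
  induction hT : swallowingTime (sleDriving κ ω) z using WithTop.recTopCoe with
  | top => exact lt_of_le_of_lt (slePointLocTime_le n ω) (WithTop.coe_lt_top _)
  | coe b =>
    obtain ⟨s, hsb, hs⟩ := imFlowStop_lt_of_near_swallowingTime (continuous_sleDriving κ ω) hz hT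
      (level_pos_lt hz n).1
    have hmem : slePointIm κ z s ω ∈ Iic (z.im / (n + 2)) := (hs s le_rfl hsb).le
    have hH : slePointImTime κ z n ω ≤ s := hittingAfter_le_of_mem bot_le hmem
    exact lt_of_le_of_lt ((slePointLocTime_le_imTime n ω).trans hH) (WithTop.coe_lt_coe.2 hsb)

/-- Times up to `ρₙ` are before the swallowing time. [folklore] -/
theorem coe_lt_swallowingTime_of_le_locTime (hz : 0 < z.im) {n : ℕ} {ω : ℝ≥0 → ℝ} {s : ℝ≥0}
    (hs : (s : WithTop ℝ≥0) ≤ slePointLocTime κ z n ω) :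
    (s : WithTop ℝ≥0) < swallowingTime (sleDriving κ ω) z :=
  lt_of_le_of_lt hs (slePointLocTime_lt_swallowingTime hz n ω)

/-- A continuous path which is `≥ c` strictly before a positive time is `≥ c` at that time.
[folklore] -/
theorem le_apply_of_forall_lt {u : ℝ≥0 → ℝ} (hu : Continuous u) {c : ℝ} {H : ℝ≥0} (hH : 0 < H)
    (h : ∀ s, s < H → c ≤ u s) : c ≤ u H := by
  have hcl : IsClosed {s : ℝ≥0 | c ≤ u s} := isClosed_le continuous_const hu
  have hsub : Iio H ⊆ {s : ℝ≥0 | c ≤ u s} := fun s hs ↦ h s hs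
  have hmem : H ∈ closure (Iio H) := by
    rw [closure_Iio' (show (Iio H).Nonempty from ⟨0, hH⟩)]
    exact self_mem_Iic
  exact hcl.closure_subset_iff.2 hsub hmem

/-- **On `[0, ρₙ]` the imaginary part is at least `im z/(n+2)`.** [folklore] -/
theorem level_le_slePointIm (hz : 0 < z.im) {n : ℕ} {ω : ℝ≥0 → ℝ} {s : ℝ≥0}
    (hs : (s : WithTop ℝ≥0) ≤ slePointLocTime κ z n ω) : z.im / (n + 2) ≤ slePointIm κ z s ω := by
  have hsH : (s : WithTop ℝ≥0) ≤ slePointImTime κ z n ω := hs.trans (slePointLocTime_le_imTime n ω)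
  -- strictly before `Hₙ` the path is above the level
  have hbefore : ∀ r : ℝ≥0, (r : WithTop ℝ≥0) < slePointImTime κ z n ω →
      z.im / (n + 2) ≤ slePointIm κ z r ω := fun r hr ↦ by
    have := notMem_of_coe_lt_hittingAfter_zero (u := slePointIm κ z) (s := Iic (z.im / (n + 2))) hr
    exact (not_le.1 this).le
  rcases hsH.lt_or_eq with hlt | heq
  · exact hbefore s hlt
  · -- `s = Hₙ > 0`: pass to the limit from the left
    have hpos : 0 < s := by
      by_contra h0
      have hs0 : s = 0 := le_antisymm (not_lt.1 h0) bot_le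
      have hmem := mem_of_hittingAfter_zero_eq_coe (u := slePointIm κ z) isClosed_Iic
        (continuous_slePointIm hz ω) heq.symm
      rw [hs0, mem_Iic, slePointIm_apply, imFlowStop_zero (continuous_sleDriving κ ω) hz] at hmem
      exact absurd hmem (not_le.2 (level_pos_lt hz n).2)
    refine le_apply_of_forall_lt (continuous_slePointIm hz ω) hpos fun r hr ↦ hbefore r ?_
    rw [← heq]; exact_mod_cast hr

/-- **On `[0, ρₙ]` the driving function is bounded by `n + 1`.** [folklore] -/
theorem abs_sleDriving_le_of_le_locTime {n : ℕ} {ω : ℝ≥0 → ℝ} {s : ℝ≥0}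
    (hs : (s : WithTop ℝ≥0) ≤ slePointLocTime κ z n ω) : |sleDriving κ ω s| ≤ n + 1 := by
  have hsS : (s : WithTop ℝ≥0) ≤ sleDrivingTime κ n ω := hs.trans (slePointLocTime_le_drivingTime n ω)
  have hbefore : ∀ r : ℝ≥0, (r : WithTop ℝ≥0) < sleDrivingTime κ n ω → |sleDriving κ ω r| ≤ n + 1 :=
    fun r hr ↦ by
      have := notMem_of_coe_lt_hittingAfter_zero (u := fun t ω ↦ |sleDriving κ ω t|)
        (s := Ici ((n : ℝ) + 1)) hr
      exact (not_le.1 this).le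
  rcases hsS.lt_or_eq with hlt | heq
  · exact hbefore s hlt
  · have hpos : 0 < s := by
      by_contra h0
      have hs0 : s = 0 := le_antisymm (not_lt.1 h0) bot_le
      have hmem := mem_of_hittingAfter_zero_eq_coe (u := fun t ω ↦ |sleDriving κ ω t|) isClosed_Ici
        ((continuous_sleDriving κ ω).abs) heq.symm
      rw [hs0, mem_Ici, sleDriving_zero, abs_zero] at hmem
      linarith
    have h := le_apply_of_forall_lt (u := fun r ↦ -|sleDriving κ ω r|) ((continuous_sleDriving κ ω).abs.neg)
      (c := -((n : ℝ) + 1)) hpos fun r hr ↦ neg_le_neg (hbefore r (by rw [← heq]; exact_mod_cast hr))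
    linarith

/-- `|xₛ| ≤ |x₀| + ?`-type bounds are not needed; instead: **on `[0, ρₙ]`, `|zₛ|² ≥ (im z/(n+2))²`**.
[folklore] -/
theorem sq_level_le_normSq_centredMap (hz : 0 < z.im) {n : ℕ} {ω : ℝ≥0 → ℝ} {s : ℝ≥0}
    (hs : (s : WithTop ℝ≥0) ≤ slePointLocTime κ z n ω) :
    (z.im / (n + 2)) ^ 2 ≤ Complex.normSq (centredMap (sleDriving κ ω) s z) := by
  have h1 := level_le_slePointIm hz hs
  rw [slePointIm_of_lt (coe_lt_swallowingTime_of_le_locTime hz hs)] at h1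
  rw [Complex.normSq_apply]
  have h0 : 0 ≤ z.im / (n + 2) := (level_pos_lt hz n).1.le
  nlinarith [sq_nonneg (centredMap (sleDriving κ ω) s z).re]

/-- **Monotonicity of the localizing times in `n`** (`im z > 0`: the levels `im z/(n+2)` decrease,
the levels `n + 1` increase). [folklore] -/
theorem slePointLocTime_mono (hz : 0 < z.im) (ω : ℝ≥0 → ℝ) :
    Monotone fun n ↦ slePointLocTime κ z n ω := by
  refine monotone_nat_of_le_succ fun n ↦ ?_
  simp only [slePointLocTime]
  refine min_le_min ?_ (min_le_min ?_ ?_)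
  · refine hittingAfter_apply_anti _ _ _ (Iic_subset_Iic.2 ?_)
    push_cast
    exact div_le_div_of_nonneg_left hz.le (by positivity) (by linarith)
  · exact hittingAfter_apply_anti _ _ _ (Ici_subset_Ici.2 (by push_cast; linarith))
  · exact WithTop.coe_le_coe.2
      (add_le_add (by exact_mod_cast Nat.le_succ n) le_rfl : (n : ℝ≥0) + 1 ≤ ((n + 1 : ℕ) : ℝ≥0) + 1)

/-- **Exhaustion**: every time `t < τ(z)` is `≤ ρₙ` for all large `n` (`y` is bounded below on
`[0, t]` by `yₜ > 0`, `W` is bounded on `[0, t]`). [cite: RohdeSchramm2005, Lemma 6.3 (proof)] -/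
theorem exists_le_slePointLocTime (hz : 0 < z.im) (ω : ℝ≥0 → ℝ) {t : ℝ≥0}
    (ht : (t : WithTop ℝ≥0) < swallowingTime (sleDriving κ ω) z) :
    ∃ N : ℕ, ∀ n, N ≤ n → (t : WithTop ℝ≥0) ≤ slePointLocTime κ z n ω := by
  have hW := continuous_sleDriving κ ω
  -- lower bound for `y` on `[0, t]`
  have hyt : 0 < slePointIm κ z t ω := (imFlowStop_pos_iff hW hz).2 ht
  have hy : ∀ s : ℝ≥0, s ≤ t → slePointIm κ z t ω ≤ slePointIm κ z s ω := fun s hs ↦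
    imFlowStop_antitone hW hz hs
  -- upper bound for `|W|` on `[0, t]`
  obtain ⟨C, hC⟩ : ∃ C, ∀ s ∈ Icc (0 : ℝ≥0) t, |sleDriving κ ω s| ≤ C := by
    obtain ⟨C, hC⟩ := isCompact_Icc.exists_bound_of_continuousOn (hW.continuousOn (s := Icc 0 t))
    exact ⟨C, fun s hs ↦ by simpa [Real.norm_eq_abs] using hC s hs⟩
  -- choose `N`
  obtain ⟨N₁, hN₁⟩ := exists_nat_gt (z.im / slePointIm κ z t ω)
  obtain ⟨N₂, hN₂⟩ := exists_nat_gt (max C (t : ℝ))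
  refine ⟨max N₁ N₂, fun n hn ↦ ?_⟩
  have hn₁ : (N₁ : ℝ) ≤ n := by exact_mod_cast (le_max_left _ _).trans hn
  have hn₂ : (N₂ : ℝ) ≤ n := by exact_mod_cast (le_max_right _ _).trans hn
  have hlevel : z.im / (n + 2) < slePointIm κ z t ω := by
    rw [div_lt_iff₀ (by positivity)]
    have h1 : z.im / slePointIm κ z t ω < n + 2 := by linarith
    rw [div_lt_iff₀ hyt] at h1
    linarith
  have hCn : C < n + 1 := by linarith [le_max_left C (t : ℝ)]
  have htn : (t : ℝ) < n + 1 := by linarith [le_max_right C (t : ℝ)]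
  simp only [slePointLocTime]
  refine le_min ?_ (le_min ?_ ?_)
  · -- `t ≤ Hₙ`: no visit of the level by time `t`
    by_contra hlt
    rw [not_le] at hlt
    obtain ⟨j, hjt, hj⟩ := (hittingAfter_zero_le_coe_iff isClosed_Iic (continuous_slePointIm hz ω)).1 hlt.le
    exact absurd ((hy j hjt).trans (mem_Iic.1 hj)) (not_le.2 hlevel)
  · by_contra hlt
    rw [not_le] at hlt
    obtain ⟨j, hjt, hj⟩ := (hittingAfter_zero_le_coe_iff isClosed_Ici ((hW).abs)).1 hlt.le
    have := hC j ⟨bot_le, hjt⟩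
    exact absurd ((mem_Ici.1 hj).trans this) (not_le.2 hCn)
  · exact_mod_cast htn.le

end Literature.Probability.RandomPlanarGeometry
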